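import Mathlib
import Summits.NavierStokesRegularity.NavierStokesRegularity.Theorems.EulerZoomLiouvillePowerGaugeEulerLiouvilleGalileanTensorTest
import Summits.NavierStokesRegularity.NavierStokesRegularity.Theorems.EulerZoomLiouvillePowerGaugeEulerLiouvilleGalileanHarmonicShear
import Summits.NavierStokesRegularity.NavierStokesRegularity.Theorems.EulerZoomLiouvillePowerGaugeEulerLiouvilleSelfSimilarEndpointProfilePoisson
import HarnessLib

/-!
# Crux E `PowerGaugeEulerLiouville` (stmt-NavierStokesRegularity-19832), line `galilean-frames` (ns-idea-11 g6/g7), stub F3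
# `stub_wanderingReduce` — tools III: SLICES OF A WANDERING MEMBER IN THE SIMILARITY FRAME; AFFINE PULL-BACKS OF TEST FIELDS (width seat ns-ezl-w3 g5)

Route №10 `EulerZoomLiouville` (NavierStokesRegularity), crux E.  A WANDERING self-similar slice `U(y) = (T−τ)^{γ−1} V((T−τ)^{−γ}(y − x))`
(`τ < T`) in the similarity frame `y = x + (T−τ)^γ Y`:

* `integral_inner_wanderingSlice` — `∫⟪U, Φ⟫ = (T−τ)^{4γ−1} ∫⟪V(Y), Φ(x + (T−τ)^γ Y)⟫ dY`;
* `integral_inner_clm_wanderingSlice` — `∫⟪U, Ψ U⟫ = (T−τ)^{5γ−2} ∫⟪V(Y), Ψ(x + (T−τ)^γ Y) V(Y)⟫ dY`;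
* `locallyIntegrable_wanderingSlice`, `locallyIntegrable_norm_sq_wanderingSlice` — `U, |U|² ∈ L¹_loc` when `V, |V|² ∈ L¹_loc`;
* `isTestFunctionOn_comp_smul_sub`, `fderiv_comp_smul_sub`, `gradient_comp_smul_sub` — the pull-back `y ↦ Ψ(c • (y − x₀))` of a test field
  is a test field, with `D = c • DΨ(…)`;
* `rpow_velocity_mul_jacobian`, `rpow_velocity_sq_mul_jacobian` — the power bookkeeping `(T−τ)^{γ−1}((T−τ)^γ)³ = (T−τ)^{4γ−1}` etc.

WHAT THIS IS NOT: not NS regularity, not the crux E — tools for one stratum of the crux CLASS 19832 (MODEL lattice; E/NS strata),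
`--supports` stmt-19832; 19832 OPEN. [folklore]
-/

noncomputable section

-- flat `Theorems/<Route><Decl>…` files of one crux share the namespace of the crux (tree convention: `Summit.<S>.<S>.…`)
set_option linter.dupNamespace false

open MeasureTheory Set Filter Topology Metric Function TopologicalSpace InnerProductSpace
open scoped ENNReal NNReal RealInnerProductSpace ContDiff

namespace Summit.NavierStokesRegularity.NavierStokesRegularity.Theorems.PowerGaugeEulerLiouville

namespace GalileanFrames

open Literature.Analysis Literature.Analysis.FunctionSpaces Literature.Analysis.FluidPDE
open Summit.NavierStokesRegularity.NavierStokesRegularity.Theorems.PowerGaugeEulerLiouville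

variable {V : EuclideanSpace ℝ (Fin 3) → EuclideanSpace ℝ (Fin 3)} {ξ : ℝ → EuclideanSpace ℝ (Fin 3)} {γ T T₁ : ℝ}

/-! ### Power algebra at a time `τ < T` -/

/-- `(T−τ)^{γ−1}·((T−τ)^γ)³ = (T−τ)^{4γ−1}` (`T − τ > 0`). [folklore] -/
theorem rpow_velocity_mul_jacobian {l : ℝ} (hl : 0 < l) (γ : ℝ) : l ^ (γ - 1) * (l ^ γ) ^ 3 = l ^ (4 * γ - 1) := by
  rw [show ((l ^ γ) ^ 3 : ℝ) = l ^ (γ * 3) by rw [Real.rpow_mul hl.le]; norm_cast, ← Real.rpow_add hl]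
  ring_nf

/-- `((T−τ)^{γ−1})²·((T−τ)^γ)³ = (T−τ)^{5γ−2}`. [folklore] -/
theorem rpow_velocity_sq_mul_jacobian {l : ℝ} (hl : 0 < l) (γ : ℝ) : (l ^ (γ - 1)) ^ 2 * (l ^ γ) ^ 3 = l ^ (5 * γ - 2) := by
  rw [show ((l ^ γ) ^ 3 : ℝ) = l ^ (γ * 3) by rw [Real.rpow_mul hl.le]; norm_cast,
    show ((l ^ (γ - 1)) ^ 2 : ℝ) = l ^ ((γ - 1) * 2) by rw [Real.rpow_mul hl.le]; norm_cast, ← Real.rpow_add hl]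
  ring_nf

/-! ### Slices of a wandering member in the similarity frame -/

/-- A translate of a locally integrable function on `ℝ³` is locally integrable (any codomain). [folklore] -/
theorem locallyIntegrable_comp_add_right_general {F : Type*} [NormedAddCommGroup F] {g : EuclideanSpace ℝ (Fin 3) → F}
    (hg : LocallyIntegrable g volume) (v : EuclideanSpace ℝ (Fin 3)) :
    LocallyIntegrable (fun z => g (z + v)) volume := by
  have hmap : Measure.map (Homeomorph.addRight v) (volume : Measure (EuclideanSpace ℝ (Fin 3))) = volume := by
    have e : ⇑(Homeomorph.addRight v) = fun z : EuclideanSpace ℝ (Fin 3) => z + v := rfl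
    rw [e]
    exact map_add_right_eq_self volume v
  exact (locallyIntegrable_map_homeomorph (Homeomorph.addRight v) (f := g)
    (μ := (volume : Measure (EuclideanSpace ℝ (Fin 3))))).1 (by rw [hmap]; exact hg)


/-- **Slice pairing in the similarity frame**: `∫⟪(T−τ)^{γ−1}V((T−τ)^{−γ}(y − ξ)), Φ(y)⟫ dy = (T−τ)^{4γ−1} ∫⟪V(Y), Φ(ξ + (T−τ)^γ Y)⟫ dY`.
[folklore] -/
theorem integral_inner_wanderingSlice {τ : ℝ} (hτ : τ < T) (x : EuclideanSpace ℝ (Fin 3))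
    (Φ : EuclideanSpace ℝ (Fin 3) → EuclideanSpace ℝ (Fin 3)) :
    ∫ y, ⟪(T - τ) ^ (γ - 1) • V ((T - τ) ^ (-γ) • (y - x)), Φ y⟫ =
      (T - τ) ^ (4 * γ - 1) * ∫ Y, ⟪V Y, Φ (x + (T - τ) ^ γ • Y)⟫ := by
  have hl : 0 < T - τ := by linarith
  have hs : 0 < (T - τ) ^ γ := Real.rpow_pos_of_pos hl _
  rw [integral_eq_rpow_mul_integral_comp_affine _ x hs]
  have e : ∀ Y : EuclideanSpace ℝ (Fin 3),
      ⟪(T - τ) ^ (γ - 1) • V ((T - τ) ^ (-γ) • (x + (T - τ) ^ γ • Y - x)), Φ (x + (T - τ) ^ γ • Y)⟫ =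
        (T - τ) ^ (γ - 1) * ⟪V Y, Φ (x + (T - τ) ^ γ • Y)⟫ := by
    intro Y
    rw [add_sub_cancel_left, smul_smul, Real.rpow_neg hl.le, inv_mul_cancel₀ hs.ne', one_smul, real_inner_smul_left]
  simp_rw [e]
  rw [integral_const_mul, smul_eq_mul, ← mul_assoc, mul_comm (((T - τ) ^ γ) ^ 3), rpow_velocity_mul_jacobian hl]

/-- **Quadratic slice pairing in the similarity frame**:
`∫⟪U(y), Ψ(y) U(y)⟫ dy = (T−τ)^{5γ−2} ∫⟪V(Y), Ψ(ξ + (T−τ)^γ Y) V(Y)⟫ dY` for the slice `U = (T−τ)^{γ−1}V((T−τ)^{−γ}(· − ξ))`. [folklore] -/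
theorem integral_inner_clm_wanderingSlice {τ : ℝ} (hτ : τ < T) (x : EuclideanSpace ℝ (Fin 3))
    (Ψ : EuclideanSpace ℝ (Fin 3) → EuclideanSpace ℝ (Fin 3) →L[ℝ] EuclideanSpace ℝ (Fin 3)) :
    ∫ y, ⟪(T - τ) ^ (γ - 1) • V ((T - τ) ^ (-γ) • (y - x)), Ψ y ((T - τ) ^ (γ - 1) • V ((T - τ) ^ (-γ) • (y - x)))⟫ =
      (T - τ) ^ (5 * γ - 2) * ∫ Y, ⟪V Y, Ψ (x + (T - τ) ^ γ • Y) (V Y)⟫ := by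
  have hl : 0 < T - τ := by linarith
  have hs : 0 < (T - τ) ^ γ := Real.rpow_pos_of_pos hl _
  rw [integral_eq_rpow_mul_integral_comp_affine _ x hs]
  have e : ∀ Y : EuclideanSpace ℝ (Fin 3),
      ⟪(T - τ) ^ (γ - 1) • V ((T - τ) ^ (-γ) • (x + (T - τ) ^ γ • Y - x)),
        Ψ (x + (T - τ) ^ γ • Y) ((T - τ) ^ (γ - 1) • V ((T - τ) ^ (-γ) • (x + (T - τ) ^ γ • Y - x)))⟫ =
        ((T - τ) ^ (γ - 1)) ^ 2 * ⟪V Y, Ψ (x + (T - τ) ^ γ • Y) (V Y)⟫ := by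
    intro Y
    rw [add_sub_cancel_left, smul_smul, Real.rpow_neg hl.le, inv_mul_cancel₀ hs.ne', one_smul, map_smul,
      real_inner_smul_left, real_inner_smul_right]
    ring
  simp_rw [e]
  rw [integral_const_mul, smul_eq_mul, ← mul_assoc, mul_comm (((T - τ) ^ γ) ^ 3), rpow_velocity_sq_mul_jacobian hl]

/-- The slices of a wandering member are locally integrable (`V ∈ L¹_loc`). [folklore] -/
theorem locallyIntegrable_wanderingSlice (hV : LocallyIntegrable V volume) {τ : ℝ} (hτ : τ < T)
    (x : EuclideanSpace ℝ (Fin 3)) :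
    LocallyIntegrable (fun y => (T - τ) ^ (γ - 1) • V ((T - τ) ^ (-γ) • (y - x))) volume := by
  have hl : 0 < T - τ := by linarith
  have hd : (T - τ) ^ (-γ) ≠ 0 := (Real.rpow_pos_of_pos hl _).ne'
  have h1 : LocallyIntegrable (fun y => V ((T - τ) ^ (-γ) • y)) volume := locallyIntegrable_comp_smul hV hd
  have h2 := locallyIntegrable_comp_add_right_general h1 (-x)
  simp only [← sub_eq_add_neg] at h2
  exact h2.smul ((T - τ) ^ (γ - 1))

/-- The slices of a wandering member have locally integrable squares (`|V|² ∈ L¹_loc`). [folklore] -/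
theorem locallyIntegrable_norm_sq_wanderingSlice (hV2 : LocallyIntegrable (fun z => ‖V z‖ ^ 2) volume) {τ : ℝ} (hτ : τ < T)
    (x : EuclideanSpace ℝ (Fin 3)) :
    LocallyIntegrable (fun y => ‖(T - τ) ^ (γ - 1) • V ((T - τ) ^ (-γ) • (y - x))‖ ^ 2) volume := by
  have hl : 0 < T - τ := by linarith
  have hd : (T - τ) ^ (-γ) ≠ 0 := (Real.rpow_pos_of_pos hl _).ne'
  have h1 : LocallyIntegrable (fun y => ‖V ((T - τ) ^ (-γ) • y)‖ ^ 2) volume :=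
    locallyIntegrable_comp_smul (g := fun z => ‖V z‖ ^ 2) hV2 hd
  have h2 := locallyIntegrable_comp_add_right_general h1 (-x)
  simp only [← sub_eq_add_neg] at h2
  have e : (fun y => ‖(T - τ) ^ (γ - 1) • V ((T - τ) ^ (-γ) • (y - x))‖ ^ 2) =
      fun y => ((T - τ) ^ (γ - 1)) ^ 2 * ‖V ((T - τ) ^ (-γ) • (y - x))‖ ^ 2 := by
    funext y
    rw [norm_smul, mul_pow, Real.norm_of_nonneg (Real.rpow_nonneg hl.le _)]
  rw [e]
  exact h2.smul (((T - τ) ^ (γ - 1)) ^ 2)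

/-! ### Affine pull-backs of test fields to the similarity frame -/

/-- The differential of `y ↦ Ψ(c • (y − x₀))` is `c • DΨ(c • (y − x₀))`. [folklore] -/
theorem fderiv_comp_smul_sub {F : Type*} [NormedAddCommGroup F] [NormedSpace ℝ F] {Ψ : EuclideanSpace ℝ (Fin 3) → F}
    (hΨ : Differentiable ℝ Ψ) (c : ℝ) (x₀ y : EuclideanSpace ℝ (Fin 3)) :
    fderiv ℝ (fun y => Ψ (c • (y - x₀))) y = c • fderiv ℝ Ψ (c • (y - x₀)) := by
  have h1 : HasFDerivAt (fun y : EuclideanSpace ℝ (Fin 3) => c • (y - x₀)) (c • ContinuousLinearMap.id ℝ _) y :=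
    ((hasFDerivAt_id y).sub_const x₀).const_smul c
  have h2 := (hΨ (c • (y - x₀))).hasFDerivAt.comp y h1
  rw [show (fun y => Ψ (c • (y - x₀))) = Ψ ∘ (fun y => c • (y - x₀)) from rfl, h2.fderiv]
  ext v
  simp

/-- `y ↦ Ψ(c • (y − x₀))` (`c ≠ 0`) is a test field when `Ψ` is. [folklore] -/
theorem isTestFunctionOn_comp_smul_sub {F : Type*} [NormedAddCommGroup F] [NormedSpace ℝ F] {Ψ : EuclideanSpace ℝ (Fin 3) → F}
    (hΨ : IsTestFunctionOn (⊤ : Opens (EuclideanSpace ℝ (Fin 3))) Ψ) {c : ℝ} (hc : c ≠ 0) (x₀ : EuclideanSpace ℝ (Fin 3)) :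
    IsTestFunctionOn (⊤ : Opens (EuclideanSpace ℝ (Fin 3))) (fun y => Ψ (c • (y - x₀))) where
  contDiff := hΨ.contDiff.comp ((contDiff_id.sub contDiff_const).const_smul c)
  hasCompactSupport := by
    set e : EuclideanSpace ℝ (Fin 3) ≃ₜ EuclideanSpace ℝ (Fin 3) :=
      (Homeomorph.addRight (-x₀)).trans (Homeomorph.smulOfNeZero c hc) with he
    have h := hΨ.hasCompactSupport.comp_homeomorph e
    have heq : (Ψ ∘ e) = fun y => Ψ (c • (y - x₀)) := by
      funext y
      simp [he, Homeomorph.trans_apply, sub_eq_add_neg]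
    rwa [heq] at h
  tsupport_subset := by simp

/-- The field `Y ↦ DΨ(Y)·Y` of a test field has compact support. [folklore] -/
theorem hasCompactSupport_fderiv_apply_self {Ψ : EuclideanSpace ℝ (Fin 3) → EuclideanSpace ℝ (Fin 3)}
    (hΨ : IsTestFunctionOn (⊤ : Opens (EuclideanSpace ℝ (Fin 3))) Ψ) : HasCompactSupport fun Y => (fderiv ℝ Ψ Y) Y := by
  refine HasCompactSupport.intro (hΨ.hasCompactSupport.fderiv (𝕜 := ℝ)) fun Y hY => ?_
  rw [image_eq_zero_of_notMem_tsupport hY]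
  rfl

/-- The gradient of `y ↦ φ(c • (y − x₀))` is `c • ∇φ(c • (y − x₀))`. [folklore] -/
theorem gradient_comp_smul_sub {φ : EuclideanSpace ℝ (Fin 3) → ℝ} (hφ : Differentiable ℝ φ) (c : ℝ)
    (x₀ y : EuclideanSpace ℝ (Fin 3)) : gradient (fun y => φ (c • (y - x₀))) y = c • gradient φ (c • (y - x₀)) := by
  rw [gradient, gradient, fderiv_comp_smul_sub hφ c x₀ y, map_smul]


end GalileanFrames

end Summit.NavierStokesRegularity.NavierStokesRegularity.Theorems.PowerGaugeEulerLiouville
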